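import Summits.Langlands.Langlands.Theorems.QuadraticWindowHostInducedRepAsaiPoleInducedCont
import Literature.NumberTheory.Automorphic.AsaiSignContinuation

/-!
# Asai poles of an automorphic induction — the Grbac–Shahidi fact — companion file B of stub
`stub_asaiPoleInduced` of line `one-transparent-pane`
(crux `Summit.Langlands.Langlands.Theses.QuadraticWindow.HostInducedRep`, item stmt-Langlands-10902)

LOG (landing worker, wave 3, 2026-08-16).  Contents:
* `GrbacShahidi2015_partialAsaiL_at_one` — NEW named fact (a `def … : Prop` stated INLINE, for the gate
  to relocate to `Literature/NumberTheory/Automorphic/AsaiSignContinuation.lean`, which imports every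
  notion it mentions): Grbac–Shahidi 2015, Thm. 4.3 (1), (2)(a)–(b) AT `s = 1`, for PARTIAL Asai
  `L`-functions of a.e.-unitary cuspidal data, in CONTINUATION form (true as printed — see the docstring
  for the derivation from print; the raw-product currency is NOT asserted).  Its body is, verbatim,
  hypothesis `H₂` of the registered `stub_asaiPoleInduced_cond` (`…AsaiPoleInduced.lean`) and of
  `stub_asaiPoleInduced_cont` (`…AsaiPoleInducedCont.lean`).
* `stub_asaiPoleInduced_of_facts` — the transfer with the Grbac–Shahidi hypothesis supplied by the named
  fact (remaining hypotheses: Mok's corrected continuation statement, the currency hypothesis `H₃`).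
* `exists_hasAsaiSign_of_hsign` — REGISTERED ANCHOR, fact-free: hypothesis `H₁` of
  `stub_asaiPoleInduced_cond` supplies the pane law's existence hypothesis `hex`.
Landed chain: AsaiLocalInduced p115698 · AsaiTowerPlaces p115887 · AsaiLocalIdentity p116404 · AsaiFibreProducts
p116604 · AsaiLocalIdentityQ p116811 · AsaiGlobalFactorisation p116974 · AsaiPoleInduced (`stub_asaiPoleInduced_cond`)
p117138 · AsaiPoleInducedCont (`stub_asaiPoleInduced_cont`, `hsign_of_continuation`) p117243.
-/

set_option linter.dupNamespace false -- project-wide option (lakefile weak.linter.dupNamespace); `Summit.Langlands.Langlands` is the mandated namespace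

open scoped Classical Topology
open Literature.NumberTheory.Automorphic
open IsDedekindDomain NumberField Polynomial Filter

namespace Summit.Langlands.Langlands.Theorems.HostInducedRep.OneTransparentPane

/-! ### The named fact: Grbac–Shahidi 2015, Thm. 4.3, at `s = 1`, for partial Asai `L`-functions -/

/-- **The transfer modulo the named facts**: `stub_asaiPoleInduced_cont` with the Grbac–Shahidi
hypothesis supplied by the named fact `GrbacShahidi2015_partialAsaiL_at_one` (the remaining hypotheses:
Mok's corrected continuation statement and the currency hypothesis `H₃`).
[cite: GrbacShahidi2015, Thm. 4.3] [cite: Mok2014, Thm. 2.5.4 (a)] -/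
theorem stub_asaiPoleInduced_of_facts (hGS : Literature.NumberTheory.Automorphic.GrbacShahidi2015_partialAsaiL_at_one)
    (h : ∀ (F E : Type) [Field F] [NumberField F] [Field E] [NumberField E] [Algebra F E]
        (c : E ≃ₐ[F] E), Module.finrank F E = 2 → c ≠ 1 →
        ∀ (N : ℕ) (hcpt : isCompact_glFiniteIntegralLevel N E)
          (π : CuspidalAutomorphicRepData N E hcpt), 0 < N → π.1.IsConjSelfDualAE c →
          ∃ η : ℤˣ, ∀ (S : Set (HeightOneSpectrum (𝓞 F))) (A : SatakeFamily E),
            π.1.IsAsaiDatum c S A →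
              ∃ σ₀ : ℝ, 1 ≤ σ₀ ∧
                (∀ (θ : ℤˣ) (s : ℂ), σ₀ < s.re →
                  Multipliable fun v : {v : HeightOneSpectrum (𝓞 F) // v ∉ S} =>
                    ((asaiLocalPolynomial c A θ (placeAbove E v.1)).eval
                      ((v.1.residueCard : ℂ) ^ (-s)))⁻¹) ∧
                (∃ G : ℂ → ℂ, DifferentiableOn ℂ G {s : ℂ | 1 / 2 < s.re} ∧
                  (∀ s : ℂ, σ₀ < s.re → G s = (s - 1) * partialAsaiL S c A η s) ∧ G 1 ≠ 0) ∧
                (∃ H : ℂ → ℂ, DifferentiableOn ℂ H {s : ℂ | 1 / 2 < s.re} ∧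
                  (∀ s : ℂ, σ₀ < s.re → H s = partialAsaiL S c A (-η) s) ∧ H 1 ≠ 0))
    (hhol : ∀ (F E : Type) [Field F] [NumberField F] [Field E] [NumberField E] [Algebra F E]
      (c : E ≃ₐ[F] E), Module.finrank F E = 2 → c ≠ 1 →
      ∀ (N : ℕ) (hcpt : isCompact_glFiniteIntegralLevel N E) (π : CuspidalAutomorphicRepData N E hcpt),
        0 < N →
        (∀ᶠ w : HeightOneSpectrum (𝓞 E) in cofinite, ∀ α : Multiset ℂ,
          π.1.HasSatakeParamAt w α → ‖α.prod‖ = 1) →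
        ∀ (S : Set (HeightOneSpectrum (𝓞 F))) (A : SatakeFamily E) (θ : ℤˣ), π.1.IsAsaiDatum c S A →
          DifferentiableOn ℂ (partialAsaiL S c A θ) {s : ℂ | 1 < s.re})
    {F₀ K F' L : Type} [Field F₀] [NumberField F₀] [Field K] [NumberField K] [Field F'] [NumberField F']
    [Field L] [NumberField L] [Algebra F₀ K] [Algebra K L] [Algebra F' L] {cK : K ≃ₐ[F₀] K}
    {s : L ≃ₐ[F'] L} (h2 : Module.finrank F₀ K = 2) (h2K : Module.finrank K L = 2)
    (h2F' : Module.finrank F' L = 2) (hcK : cK ≠ 1) (hs : s ≠ 1)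
    (hsK : ∀ x : K, s (algebraMap K L x) = algebraMap K L (cK x))
    {n : ℕ} {hL : isCompact_glFiniteIntegralLevel n L} {hK : isCompact_glFiniteIntegralLevel (2 * n) K}
    (P : CuspidalAutomorphicRepData n L hL) (Q : CuspidalAutomorphicRepData (2 * n) K hK) (hn : 0 < n)
    (hAI : IsAutomorphicInductionAlong P.1 Q.1) (hP : P.1.IsConjSelfDualAE s)
    (hQ : Q.1.IsConjSelfDualAE cK) (ε : ℤˣ) : Q.1.HasAsaiPole cK ε ↔ P.1.HasAsaiPole s ε :=
  stub_asaiPoleInduced_cont h hGS hhol F₀ K F' L cK s h2 h2K h2F' hcK hs hsK n hL hK P Q hn hAI hP hQ ε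

/-! ### `H₁` and the pane law's `hex` -/

/-- **`H₁` supplies the pane law's existence hypothesis `hex`**: a typed pole sign `η` of `P` is the
Asai sign `κ = (-1)^{N+1} η` (`hasAsaiPole_iff_hasAsaiSign`); verbatim the first hypothesis of the landed
`stub_paneLaw_cond`.  Fact-free. [cite: Mok2014, Thm. 2.5.4 (a)] -/
theorem exists_hasAsaiSign_of_hsign :
    (∀ (F E : Type) [Field F] [NumberField F] [Field E] [NumberField E] [Algebra F E]
      (c : E ≃ₐ[F] E), Module.finrank F E = 2 → c ≠ 1 →
      ∀ (N : ℕ) (hcpt : isCompact_glFiniteIntegralLevel N E) (π : CuspidalAutomorphicRepData N E hcpt),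
        0 < N → π.1.IsConjSelfDualAE c →
        ∃ η : ℤˣ, π.1.HasAsaiPole c η ∧
          ∀ (S : Set (HeightOneSpectrum (𝓞 F))) (A : SatakeFamily E), π.1.IsAsaiDatum c S A →
            ∃ r : ℂ, Tendsto (partialAsaiL S c A (-η)) (𝓝[{s : ℂ | 1 < s.re}] 1) (𝓝 r)) →
    ∀ (F E : Type) [Field F] [NumberField F] [Field E] [NumberField E] [Algebra F E]
      (c : E ≃ₐ[F] E), Module.finrank F E = 2 → c ≠ 1 →
      ∀ (N : ℕ) (hcpt : isCompact_glFiniteIntegralLevel N E) (P : CuspidalAutomorphicRepData N E hcpt),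
      0 < N → P.1.IsConjSelfDualAE c → ∃ κ : ℤˣ, P.1.HasAsaiSign c κ := by
  intro hsign F E _ _ _ _ _ c h2 hc N hcpt P hN hP
  obtain ⟨η, hη, -⟩ := hsign F E c h2 hc N hcpt P hN hP
  exact ⟨(-1) ^ (N + 1) * η, (P.1.hasAsaiPole_iff_hasAsaiSign c η).mp hη⟩

end Summit.Langlands.Langlands.Theorems.HostInducedRep.OneTransparentPane
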